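import Literature.AlgebraicGeometry.Resolution.RegularLocalRingsQuotient
import Mathlib.RingTheory.RegularLocalRing.Polynomial
import Mathlib.RingTheory.Derivation.MapCoeffs
import Mathlib.RingTheory.Localization.LocalizationLocalization
import Mathlib.RingTheory.Ideal.Over
import Mathlib.RingTheory.AdjoinRoot
import Mathlib.FieldTheory.IntermediateField.Adjoin.Basic
import HarnessLib

/-!
# Regular quotients cut out by a derivation (Stacks 07PF, 07PG) and simple base changes

Topic: `Literature/AlgebraicGeometry/Resolution`. The "engine" of the Stacks Project's proof
(Tag 07PR) of the characteristic-`p` half of Matsumura's Thm. 32.3 (`FormalFibres.lean`, leaf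
`Matsumura1987_32_3_regular`), PROVED:

* `isRegularRing_quotient_of_derivation` — **Stacks 07PF**: "Let `R` be a regular ring. Let
  `f ∈ R`. Assume there exists a derivation `D : R → R` such that `D(f)` is a unit of `R/(f)`.
  Then `R/(f)` is regular." (At a prime `𝔮 ∋ f`: `D(𝔮²) ⊆ 𝔮` forces `f ∉ 𝔮²R_𝔮`, and
  `R_𝔮/(f)` is regular by Matsumura Thm. 14.2, `IsRegularLocalRing.quotient_span_singleton`.)
* `isRegularRing_adjoinRoot_X_pow_sub_C_of_derivation` — **Stacks 07PG**: "Let `R` be a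
  regular ring and `f ∈ R`. Assume there exists a derivation `D : R → R` such that `D(f)` is a
  unit of `R`. Then `R[z]/(zⁿ - f)` is regular for any integer `n ≥ 1`." (`R[z]` is regular —
  Mathlib's `Polynomial.isRegularRing_of_isRegularRing` — and the coefficientwise extension of
  `D` with `D(z) = 0` maps `zⁿ - f` to the unit `-D(f)`.)
* `isRegularRing_adjoinRoot_of_isCoprime_derivative` — the separable companion: `R[z]/(g)` is
  regular for `g` coprime to its derivative (`D = d/dz`).
* `tensorAdjoinRingEquiv` — for a simple field extension `F' = F(θ)` and any `R`-algebra `T`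
  under `F`: `F' ⊗_R T ≅ (F ⊗_R T)[z]/(g)`, `g` the minimal polynomial of `θ`
  (`F' ≅ F[z]/(g)` and base change, Mathlib's `AdjoinRoot.tensorAlgEquiv`); whence
  `isRegularRing_tensor_of_isSeparable` (a separable simple step preserves regularity of
  `– ⊗_R T`) and `isRegularRing_tensor_of_minpoly_eq_X_pow_sub_C` (a radical step `θⁿ = a`
  does, given a derivation of `F ⊗_R T` taking `a ⊗ 1` to a unit) — the two inductive steps of
  Stacks 07PR.

## Sources

* The Stacks Project, Tags 07PF (Lemma 15.49.2), 07PG (Lemma 15.49.4), 07PR (Lemma 15.51.5).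
  [StacksProject]
* H. Matsumura, *Commutative Ring Theory*, CUP 1986, Thm. 14.2 (via
  `RegularLocalRingsQuotient.lean`). [Matsumura1987]
-/

noncomputable section

open IsLocalRing Polynomial TensorProduct

namespace Literature.AlgebraicGeometry.Resolution

universe u v w

/-! ## Stacks 07PF: `R/(f)` is regular when `D(f)` is a unit modulo `f` -/

section Stacks07PF

variable {C : Type u} [CommRing C]

/-- If `D(f)` is a unit of `C/(f)` for a derivation `D` of `C`, then `f ∉ 𝔮⁽²⁾` for every
prime `𝔮 ∋ f`, i.e. no `u ∉ 𝔮` has `uf ∈ 𝔮²` (Leibniz: `D(𝔮²) ⊆ 𝔮`).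
[cite: StacksProject, Tag 07PF] -/
theorem not_mem_sq_of_derivation_unit {S₀ : Type*} [CommSemiring S₀] {_ : Algebra S₀ C} (f : C)
    (D : Derivation S₀ C C) (hD : IsUnit (Ideal.Quotient.mk (Ideal.span {f}) (D f)))
    (Q : Ideal C) [Q.IsPrime] (hfQ : f ∈ Q) {u : C} (hu : u ∉ Q) : u * f ∉ Q ^ 2 := by
  intro huf
  have key : ∀ x ∈ Q ^ 2, D x ∈ Q := by
    intro x hx
    rw [pow_two] at hx
    refine Submodule.mul_induction_on hx (fun a ha b hb => ?_) (fun a b ha hb => ?_)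
    · rw [Derivation.leibniz, smul_eq_mul, smul_eq_mul]
      exact Q.add_mem (Q.mul_mem_right _ ha) (Q.mul_mem_right _ hb)
    · rw [map_add]
      exact Q.add_mem ha hb
  have h1 : D (u * f) ∈ Q := key _ huf
  rw [Derivation.leibniz, smul_eq_mul, smul_eq_mul] at h1
  have h2 : u * D f ∈ Q := by
    have h3 : f * D u ∈ Q := Q.mul_mem_right _ hfQ
    exact (Ideal.add_mem_iff_left Q h3).mp h1
  have hDf : D f ∈ Q := ((Ideal.IsPrime.mem_or_mem ‹_› h2).resolve_left hu)
  obtain ⟨v, hv⟩ := hD.exists_right_inv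
  obtain ⟨v, rfl⟩ := Ideal.Quotient.mk_surjective v
  rw [← map_mul, ← map_one (Ideal.Quotient.mk (Ideal.span {f})), Ideal.Quotient.eq,
    Ideal.mem_span_singleton] at hv
  obtain ⟨w, hw⟩ := hv
  have h1Q : (1 : C) ∈ Q := by
    have : D f * v - f * w ∈ Q := Q.sub_mem (Q.mul_mem_right _ hDf) (Q.mul_mem_right _ hfQ)
    rwa [← hw, sub_sub_cancel] at this
  exact Q.ne_top_iff_one.mp (Ideal.IsPrime.ne_top ‹_›) h1Q

/-- **Stacks 07PF.** "Let `R` be a regular ring. Let `f ∈ R`. Assume there exists a derivation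
`D : R → R` such that `D(f)` is a unit of `R/(f)`. Then `R/(f)` is regular." Proof: for a prime
`𝔮̄` of `R/(f)`, the preimage `𝔮 ∋ f` has `R_𝔮` regular local and `f ∈ 𝔮R_𝔮 ∖ 𝔮²R_𝔮`
(`not_mem_sq_of_derivation_unit`), so `(R/(f))_𝔮̄ = R_𝔮/(f)` is regular local (Matsumura
Thm. 14.2). [cite: StacksProject, Tag 07PF] -/
theorem isRegularRing_quotient_of_derivation [IsRegularRing C] {S₀ : Type*} [CommSemiring S₀]
    {_ : Algebra S₀ C} (f : C) (D : Derivation S₀ C C)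
    (hD : IsUnit (Ideal.Quotient.mk (Ideal.span {f}) (D f))) :
    IsRegularRing (C ⧸ Ideal.span {f}) := by
  refine isRegularRing_iff.mpr fun P hP => ?_
  let Q : Ideal C := P.comap (Ideal.Quotient.mk (Ideal.span {f}))
  haveI hQ : Q.IsPrime := Ideal.comap_isPrime _ P
  have hf0 : Ideal.Quotient.mk (Ideal.span {f}) f = 0 :=
    Ideal.Quotient.eq_zero_iff_mem.mpr (Ideal.subset_span (Set.mem_singleton f))
  have hfQ : f ∈ Q := by
    change Ideal.Quotient.mk (Ideal.span {f}) f ∈ P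
    rw [hf0]
    exact P.zero_mem
  -- the regular local ring `C_Q` and `f ∈ 𝔪 ∖ 𝔪²`
  have hfm : algebraMap C (Localization.AtPrime Q) f ∈ maximalIdeal (Localization.AtPrime Q) := by
    rw [← Localization.AtPrime.map_eq_maximalIdeal]
    exact Ideal.mem_map_of_mem _ hfQ
  have hfm2 : algebraMap C (Localization.AtPrime Q) f ∉
      maximalIdeal (Localization.AtPrime Q) ^ 2 := by
    rw [← Localization.AtPrime.map_eq_maximalIdeal, ← Ideal.map_pow,
      IsLocalization.algebraMap_mem_map_algebraMap_iff Q.primeCompl]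
    rintro ⟨u, hu, huf⟩
    exact not_mem_sq_of_derivation_unit f D hD Q hfQ hu huf
  have hreg : IsRegularLocalRing
      (Localization.AtPrime Q ⧸ Ideal.span {algebraMap C (Localization.AtPrime Q) f}) :=
    (IsRegularLocalRing.quotient_span_singleton hfm hfm2).1
  have hmap : (Ideal.span {f}).map (algebraMap C (Localization.AtPrime Q)) =
      Ideal.span {algebraMap C (Localization.AtPrime Q) f} := by
    rw [Ideal.map_span, Set.image_singleton]
  -- `(C/(f))_P ≅ C_Q/(f)`
  have hsub : Algebra.algebraMapSubmonoid (C ⧸ Ideal.span {f}) Q.primeCompl = P.primeCompl := by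
    ext x
    constructor
    · rintro ⟨c, hc, rfl⟩
      exact hc
    · intro hx
      obtain ⟨c, rfl⟩ := Ideal.Quotient.mk_surjective x
      exact ⟨c, hx, rfl⟩
  haveI : IsLocalization.AtPrime
      (Localization.AtPrime Q ⧸ (Ideal.span {f}).map (algebraMap C (Localization.AtPrime Q)))
      P := by
    change IsLocalization P.primeCompl _
    rw [← hsub]
    infer_instance
  let e : Localization.AtPrime P ≃ₐ[C ⧸ Ideal.span {f}]
      Localization.AtPrime Q ⧸ (Ideal.span {f}).map (algebraMap C (Localization.AtPrime Q)) :=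
    IsLocalization.algEquiv P.primeCompl _ _
  let e' : (Localization.AtPrime Q ⧸ (Ideal.span {f}).map (algebraMap C (Localization.AtPrime Q)))
      ≃+* Localization.AtPrime Q ⧸ Ideal.span {algebraMap C (Localization.AtPrime Q) f} :=
    Ideal.quotEquivOfEq hmap
  haveI := hreg
  exact IsRegularLocalRing.of_ringEquiv (e.toRingEquiv.trans e').symm

end Stacks07PF

/-! ## Stacks 07PG and its separable companion -/

section Stacks07PG

variable {C : Type u} [CommRing C]

/-- The coefficientwise extension `D̃` of a derivation `D` of `C` to `C[z]` (`D̃(z) = 0`) kills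
`zⁿ` and maps constants `c` to `D(c)`: `D̃(zⁿ - c) = -D(c)`. [folklore] -/
theorem mapCoeffs_X_pow_sub_C (D : Derivation ℤ C C) (n : ℕ) (c : C) :
    letI : Differential C := ⟨D⟩
    Differential.mapCoeffs ((X : C[X]) ^ n - Polynomial.C c) = -Polynomial.C (D c) := by
  letI : Differential C := ⟨D⟩
  rw [map_sub, Polynomial.X_pow_eq_monomial, Differential.mapCoeffs_monomial,
    Differential.mapCoeffs_C]
  have h1 : Differential.deriv (1 : C) = 0 := Differential.deriv.map_one_eq_zero
  rw [h1, Polynomial.monomial_zero_right, zero_sub]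
  rfl

/-- **Stacks 07PG.** "Let `R` be a regular ring and `f ∈ R`. Assume there exists a derivation
`D : R → R` such that `D(f)` is a unit of `R`. Then `R[z]/(zⁿ - f)` is regular for any integer
`n ≥ 1`." (`R[z]` is regular; extend `D` coefficientwise with `D(z) = 0`; then `D(zⁿ - f) = -D(f)`
is a unit, and 07PF applies. The statement holds for every `n`.) [cite: StacksProject, Tag 07PG] -/
theorem isRegularRing_adjoinRoot_X_pow_sub_C_of_derivation [IsRegularRing C]
    (D : Derivation ℤ C C) (c : C) (hc : IsUnit (D c)) (n : ℕ) :
    IsRegularRing (AdjoinRoot ((X : C[X]) ^ n - Polynomial.C c)) := by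
  letI : Differential C := ⟨D⟩
  refine isRegularRing_quotient_of_derivation _ Differential.mapCoeffs ?_
  rw [mapCoeffs_X_pow_sub_C]
  exact (hc.map Polynomial.C).neg.map _

/-- **Separable companion of Stacks 07PG**: for a regular ring `R` and `g ∈ R[z]` coprime to its
derivative, `R[z]/(g)` is regular (07PF with `D = d/dz`, as `D(g) = g'` is a unit modulo `g`).
[cite: StacksProject, Tag 07PF] -/
theorem isRegularRing_adjoinRoot_of_isCoprime_derivative [IsRegularRing C] (g : C[X])
    (hg : IsCoprime g (derivative g)) : IsRegularRing (AdjoinRoot g) := by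
  refine isRegularRing_quotient_of_derivation g (Polynomial.derivative' : Derivation C C[X] C[X]) ?_
  obtain ⟨a, b, hab⟩ := hg
  change IsUnit (Ideal.Quotient.mk (Ideal.span {g}) (derivative g))
  refine IsUnit.of_mul_eq_one (Ideal.Quotient.mk (Ideal.span {g}) b) ?_
  rw [← map_mul, ← map_one (Ideal.Quotient.mk (Ideal.span {g})), Ideal.Quotient.eq,
    Ideal.mem_span_singleton]
  exact ⟨-a, by linear_combination hab⟩

end Stacks07PG

/-! ## Simple extensions of the field factor of a base change -/

section SimpleStep

variable {R : Type u} [CommRing R] (T : Type v) [CommRing T] [Algebra R T]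
  (F : Type w) [Field F] [Algebra R F] {F' : Type w} [Field F'] [Algebra F F'] [Algebra R F']
  [IsScalarTower R F F']

/-- A simple algebraic extension `F' = F(θ)` is `F[z]/(minpoly θ)`. [folklore] -/
def algEquivAdjoinRootOfAdjoinEqTop {θ : F'} (hθ : IsIntegral F θ)
    (htop : IntermediateField.adjoin F {θ} = ⊤) : F' ≃ₐ[F] AdjoinRoot (minpoly F θ) :=
  IntermediateField.topEquiv.symm.trans
    ((IntermediateField.equivOfEq htop).symm.trans
      (IntermediateField.adjoinRootEquivAdjoin F hθ).symm)

variable (R) in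
/-- The polynomial `g ⊗ 1` over `(F ⊗_R T) ⊗_F F ≅ F ⊗_R T` is `g` with coefficients in
`F ⊗_R T`. [folklore] -/
theorem map_map_rid_eq (g : F[X]) :
    (g.map (Algebra.TensorProduct.includeRight (R := F) (A := F ⊗[R] T) (B := F)).toRingHom).map
      ((Algebra.TensorProduct.rid F (F ⊗[R] T) (F ⊗[R] T)).toRingEquiv :
        (F ⊗[R] T) ⊗[F] F →+* F ⊗[R] T) = g.map (algebraMap F (F ⊗[R] T)) := by
  rw [Polynomial.map_map]
  congr 1
  ext x
  change Algebra.TensorProduct.rid F (F ⊗[R] T) (F ⊗[R] T) ((1 : F ⊗[R] T) ⊗ₜ[F] x) = _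
  rw [Algebra.TensorProduct.rid_tmul, Algebra.algebraMap_eq_smul_one]

variable (R) in
/-- `((F ⊗_R T) ⊗_F F)[z]/(g ⊗ 1) ≅ (F ⊗_R T)[z]/(g)` (Mathlib's `AdjoinRoot.mapRingEquiv` along
`(F ⊗_R T) ⊗_F F ≅ F ⊗_R T`). [folklore] -/
def adjoinRootRidEquiv (g : F[X]) :
    AdjoinRoot (g.map (Algebra.TensorProduct.includeRight (R := F) (A := F ⊗[R] T)
      (B := F)).toRingHom) ≃+* AdjoinRoot (g.map (algebraMap F (F ⊗[R] T))) :=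
  AdjoinRoot.mapRingEquiv (Algebra.TensorProduct.rid F (F ⊗[R] T) (F ⊗[R] T)).toRingEquiv _ _
    (map_map_rid_eq R T F g ▸ Associated.refl _)

/-- **`F(θ) ⊗_R T ≅ (F ⊗_R T)[z]/(g)`** for a simple algebraic extension `F' = F(θ)` with minimal
polynomial `g` and any `R`-algebra `T` (`R → F → F'`): `F' ≅ F[z]/(g)`
(`IntermediateField.adjoinRootEquivAdjoin`), `F' ⊗_R T = F' ⊗_F (F ⊗_R T)`, and adjoining a
root commutes with base change (`AdjoinRoot.tensorAlgEquiv`). [folklore] -/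
def tensorAdjoinRingEquiv {θ : F'} (hθ : IsIntegral F θ)
    (htop : IntermediateField.adjoin F {θ} = ⊤) :
    F' ⊗[R] T ≃+* AdjoinRoot ((minpoly F θ).map (algebraMap F (F ⊗[R] T))) :=
  (Algebra.TensorProduct.cancelBaseChange R F F' F' T).symm.toRingEquiv.trans <|
    (Algebra.TensorProduct.comm F F' (F ⊗[R] T)).toRingEquiv.trans <|
      (Algebra.TensorProduct.congr (AlgEquiv.refl : (F ⊗[R] T) ≃ₐ[F] F ⊗[R] T)
        (algEquivAdjoinRootOfAdjoinEqTop F hθ htop)).toRingEquiv.trans <|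
        (AdjoinRoot.tensorAlgEquiv (R := F) (T := F ⊗[R] T) (minpoly F θ) _ rfl).toRingEquiv.trans
          (adjoinRootRidEquiv R T F (minpoly F θ))

variable {T F}

/-- **A separable simple step preserves regularity of the base change**: if `F ⊗_R T` is a
regular ring and `F' = F(θ)` with `θ` separable over `F`, then `F' ⊗_R T ≅ (F ⊗_R T)[z]/(g)` is a
regular ring (`g = minpoly θ` is coprime to `g'`; separable companion of Stacks 07PG). This is the
"`char K = 0`: nothing to prove" step of Matsumura's proof of Thm. 32.3 and the separable part of
Stacks 07PR. [cite: StacksProject, Tag 07PR] -/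
theorem isRegularRing_tensor_of_isSeparable [IsRegularRing (F ⊗[R] T)] {θ : F'}
    (hsep : IsSeparable F θ) (htop : IntermediateField.adjoin F {θ} = ⊤) :
    IsRegularRing (F' ⊗[R] T) := by
  have hθ : IsIntegral F θ := hsep.isIntegral
  haveI : IsRegularRing (AdjoinRoot ((minpoly F θ).map (algebraMap F (F ⊗[R] T)))) :=
    isRegularRing_adjoinRoot_of_isCoprime_derivative _
      (Polynomial.Separable.map (f := algebraMap F (F ⊗[R] T)) hsep)
  exact IsRegularRing.of_ringEquiv (tensorAdjoinRingEquiv T F hθ htop).symm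

/-- **A radical step preserves regularity of the base change, given a derivation** (the
inductive step of Stacks 07PR): if `F ⊗_R T` is a regular ring carrying a derivation `D` with
`D(a ⊗ 1)` a unit, and `F' = F(θ)` with minimal polynomial `zⁿ - a`, then
`F' ⊗_R T ≅ (F ⊗_R T)[z]/(zⁿ - a ⊗ 1)` is a regular ring (Stacks 07PG).
[cite: StacksProject, Tag 07PR] -/
theorem isRegularRing_tensor_of_minpoly_eq_X_pow_sub_C [IsRegularRing (F ⊗[R] T)] {θ : F'}
    (hθ : IsIntegral F θ) (htop : IntermediateField.adjoin F {θ} = ⊤) {n : ℕ} {a : F}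
    (hmin : minpoly F θ = X ^ n - Polynomial.C a)
    (D : Derivation ℤ (F ⊗[R] T) (F ⊗[R] T))
    (hD : IsUnit (D (algebraMap F (F ⊗[R] T) a))) :
    IsRegularRing (F' ⊗[R] T) := by
  have hmap : (minpoly F θ).map (algebraMap F (F ⊗[R] T)) =
      X ^ n - Polynomial.C (algebraMap F (F ⊗[R] T) a) := by
    rw [hmin, Polynomial.map_sub, Polynomial.map_pow, Polynomial.map_X, Polynomial.map_C]
  haveI : IsRegularRing (AdjoinRoot ((minpoly F θ).map (algebraMap F (F ⊗[R] T)))) := by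
    rw [hmap]
    exact isRegularRing_adjoinRoot_X_pow_sub_C_of_derivation D _ hD n
  exact IsRegularRing.of_ringEquiv (tensorAdjoinRingEquiv T F hθ htop).symm

end SimpleStep

end Literature.AlgebraicGeometry.Resolution

end
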